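import Summits.QuantumAdvantage.QuantumAdvantage.Theorems.CubicForrelationNearExactIsExactKtThreeExceptionalStructure
import Summits.QuantumAdvantage.QuantumAdvantage.Theorems.CubicForrelationNearExactIsExactCubicFormAnnihilator
import Summits.QuantumAdvantage.QuantumAdvantage.Theorems.CubicForrelationNearExactIsExactCubicFormTriple
import Summits.QuantumAdvantage.QuantumAdvantage.Theorems.CubicForrelationNearExactIsExactCubicFormFrameLI
import Summits.QuantumAdvantage.QuantumAdvantage.Theorems.CubicForrelationNearExactIsExactAffineForm
import Summits.QuantumAdvantage.QuantumAdvantage.Theorems.CubicForrelationNearExactIsExactValueGranularity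

/-!
# Crux `CubicForrelation.NearExactIsExact` (stmt-QuantumAdvantage-14043) — the EXCEPTIONAL light cell in coordinates: `t̄ = T ⊕ T′`

Certificate seat `b2b-cforr-cert` (gen 41).  HONEST FRAMING: kernel-checked assembly (standard axioms) of …KtThreeExceptionalStructure
(`kte_exceptional_structure`), the tree's `stub_affineForm` and `mw_flat_of_minweight`, …CubicFormAnnihilator (`tca_annihilator`),
…CubicFormTriple (`tct3_third_triple_product`) and …CubicFormFrameLI (`tcl_li_of_kernel_card`, `tcl_frame_of_li`): a cubic `ρ` on `m` bits
with `32·#ρ = 7·2^m` supported in no affine hyperplane has, in a suitable linear frame `P`, the cubic form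
`t̄(Py, Py', Py'') = per(y,y',y'' | 0,1,2) ⊕ per(y,y',y'' | 3,4,5)` (`per` = sum over the six permutations of the coordinate products) —
i.e. `t̄ = s₀s₁s₂ ⊕ s₃s₄s₅ = T ⊕ T′`, radical `= {s₀ = ⋯ = s₅ = 0}`.  This is the coordinate form needed by the `T ⊕ T′` leaf (`tpa_R2_TT`:
no monomial of `t̄` through the last three coordinates) in the Lean roadmap for `E1280-even` (HOME/b2b-cforr-cert-g41/LEAN-TOOLS-GEN41.md).
Nothing about `θ₁₂`; NOT summit progress.

* `kte_third_xor`: the third difference of `f ⊕ g` is the xor of the third differences.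
* `kte_cell_coords` (**main**).

References: T. Kasami, N. Tokura (1970) Thm 1.  Axioms: the standard three.
-/

set_option linter.dupNamespace false -- D-0017: single-problem summit ⇒ `QuantumAdvantage.QuantumAdvantage` by design

noncomputable section

namespace Summit.QuantumAdvantage.QuantumAdvantage.Theorems.CubicForrelation.NearExactIsExact

open Finset Module
open Literature.Computability.QuantumComplexity
open Literature.Computability.QuantumComplexity.BuzetChailloux (bxor zeroVec bxor_comm bxor_self bxor_zeroVec zeroVec_bxor
  bxor_bxor_cancel_left bxor_eq_zeroVec_iff)

/-- Third differences are additive under `⊕`. [folklore] -/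
theorem kte_third_xor {m : ℕ} (f g : (Fin m → Bool) → Bool) (u v w x : Fin m → Bool) :
    ((((f x ^^ g x) ^^ (f (bxor x w) ^^ g (bxor x w))) ^^ ((f (bxor x v) ^^ g (bxor x v)) ^^ (f (bxor (bxor x v) w) ^^ g (bxor (bxor x v) w)))) ^^
        (((f (bxor x u) ^^ g (bxor x u)) ^^ (f (bxor (bxor x u) w) ^^ g (bxor (bxor x u) w))) ^^
          ((f (bxor (bxor x u) v) ^^ g (bxor (bxor x u) v)) ^^ (f (bxor (bxor (bxor x u) v) w) ^^ g (bxor (bxor (bxor x u) v) w))))) =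
      ((((f x ^^ f (bxor x w)) ^^ (f (bxor x v) ^^ f (bxor (bxor x v) w))) ^^
          ((f (bxor x u) ^^ f (bxor (bxor x u) w)) ^^ (f (bxor (bxor x u) v) ^^ f (bxor (bxor (bxor x u) v) w)))) ^^
        (((g x ^^ g (bxor x w)) ^^ (g (bxor x v) ^^ g (bxor (bxor x v) w))) ^^
          ((g (bxor x u) ^^ g (bxor (bxor x u) w)) ^^ (g (bxor (bxor x u) v) ^^ g (bxor (bxor (bxor x u) v) w))))) := by
  generalize f x = a₁; generalize f (bxor x w) = a₂; generalize f (bxor x v) = a₃; generalize f (bxor (bxor x v) w) = a₄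
  generalize f (bxor x u) = a₅; generalize f (bxor (bxor x u) w) = a₆; generalize f (bxor (bxor x u) v) = a₇
  generalize f (bxor (bxor (bxor x u) v) w) = a₈
  generalize g x = c₁; generalize g (bxor x w) = c₂; generalize g (bxor x v) = c₃; generalize g (bxor (bxor x v) w) = c₄
  generalize g (bxor x u) = c₅; generalize g (bxor (bxor x u) w) = c₆; generalize g (bxor (bxor x u) v) = c₇
  generalize g (bxor (bxor (bxor x u) v) w) = c₈
  revert a₁ a₂ a₃ a₄ a₅ a₆ a₇ a₈ c₁ c₂ c₃ c₄ c₅ c₆ c₇ c₈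
  decide

/-- **The exceptional light cell in coordinates.**  For a cubic `ρ` on `m` bits with `32·#ρ = 7·2^m` whose support lies in no affine
hyperplane there are `6 ≤ m` and `P, Pi` over `𝔽₂` with `P Pi = Pi P = 1` such that for all `y, y', y''` and every base point `x` the third
difference of `ρ` along `P y, P y', P y''` is
`Σ_{π ∈ S₃} y_{π0} y'_{π1} y''_{π2}` over the coordinates `{0,1,2}` `⊕` the same over `{3,4,5}` — `t̄ = s₀s₁s₂ ⊕ s₃s₄s₅`.
[this work; cite: KasamiTokura1970, Thm 1] -/
theorem kte_cell_coords {m : ℕ} (ρ : (Fin m → Bool) → Bool) (hρ : IsDegLeFun 3 ρ)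
    (hw : 32 * #(univ.filter fun x => ρ x = true) = 7 * 2 ^ m)
    (hgen : ¬ ∃ (z : Fin m → Bool) (b : Bool), z ≠ zeroVec ∧
        ∀ x, ρ x = true → decide (Odd #(univ.filter fun i => (x i && z i) = true)) = b) :
    ∃ (hm : 6 ≤ m) (P Pi : Fin m → Fin m → ZMod 2),
      (∀ ψ ω, (∑ φ, P ψ φ * Pi φ ω) = if ψ = ω then 1 else 0) ∧
      (∀ ψ ω, (∑ φ, Pi ψ φ * P φ ω) = if ψ = ω then 1 else 0) ∧
      ∀ (y y' y'' x : Fin m → Bool),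
        let Pv : (Fin m → Bool) → (Fin m → Bool) :=
          fun y ψ => decide ((∑ φ, P ψ φ * (if y φ = true then (1 : ZMod 2) else 0)) = 1)
        let e : Fin 6 → Fin m := fun i => Fin.castLE hm i
        let per : Fin m → Fin m → Fin m → Bool := fun i j k =>
          (((y i && (y' j && y'' k)) ^^ (y i && (y' k && y'' j))) ^^ ((y j && (y' i && y'' k)) ^^ (y j && (y' k && y'' i)))) ^^
            ((y k && (y' i && y'' j)) ^^ (y k && (y' j && y'' i)))
        (((ρ x ^^ ρ (bxor x (Pv y''))) ^^ (ρ (bxor x (Pv y')) ^^ ρ (bxor (bxor x (Pv y')) (Pv y'')))) ^^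
            ((ρ (bxor x (Pv y)) ^^ ρ (bxor (bxor x (Pv y)) (Pv y''))) ^^
              (ρ (bxor (bxor x (Pv y)) (Pv y')) ^^ ρ (bxor (bxor (bxor x (Pv y)) (Pv y')) (Pv y''))))) =
          (per (e 0) (e 1) (e 2) ^^ per (e 3) (e 4) (e 5)) := by
  classical
  obtain ⟨l, g, z₁, z₂, b₁, b₂, hl1, hg3, hz₁, hz₂, hz12, hgcard, hAcard, hAG, hdec⟩ := kte_exceptional_structure ρ hρ hw hgen
  set P₁ : (Fin m → Bool) → Bool := fun x => decide (Odd #(univ.filter fun i => (x i && z₁ i) = true)) with hP₁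
  set P₂ : (Fin m → Bool) → Bool := fun x => decide (Odd #(univ.filter fun i => (x i && z₂ i) = true)) with hP₂
  have hdec' : ∀ x, ρ x = ((l x && (decide (P₁ x = b₁) && decide (P₂ x = b₂))) ^^ g x) := fun x => hdec x
  have hTpos : 0 < 2 ^ m := by positivity
  -- `l` is an affine parity: `l x = [⟨x, c₀⟩ = b₀']`
  obtain ⟨c₀, b₀, hl⟩ := stub_affineForm m l hl1
  have hlx : ∀ x, l x = decide (decide (Odd #(univ.filter fun i => (x i && c₀ i) = true)) = !b₀) := by
    intro x
    have e := hl x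
    rw [vg_twist_eq_signOf, ← signOf_xor, tow_parity_comm c₀ x] at e
    have hinj : ∀ a b : Bool, signOf a = signOf b → a = b := by
      intro a b h; cases a <;> cases b <;> first | rfl | (exfalso; norm_num [signOf] at h)
    rw [hinj _ _ e]
    cases b₀ <;> cases decide (Odd #(univ.filter fun i => (x i && c₀ i) = true)) <;> rfl
  -- `g` is the indicator of a flat: periods `V₀`, a point `x₀`
  have hS : 2 ^ (2 + 1) * #(univ.filter fun x => g x = true) = 2 ^ m := by norm_num; omega
  obtain ⟨hV0, hVadd, hVcard, hVimg⟩ := mw_flat_of_minweight 2 g hg3 hS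
  set V₀ := univ.filter fun a : Fin m → Bool => ∀ x, g (bxor x a) = g x with hV₀
  obtain ⟨x₀, hx₀⟩ : (univ.filter fun x => g x = true).Nonempty := by rw [← card_pos]; omega
  have hgx₀ : g x₀ = true := (mem_filter.1 hx₀).2
  -- equations of `V₀`
  obtain ⟨d, r, hdr, ζ, uζ, hζdual, hζmem, hζcard⟩ := tca_annihilator V₀ hV0 hVadd
  have hr : r = 3 := by
    have e1 : #V₀ * 8 = 2 ^ m := by rw [hVcard]; omega
    have e2 : 2 ^ r = 8 := by
      have : #V₀ * 2 ^ r = #V₀ * 8 := by rw [hζcard, e1]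
      have hpos : 0 < #V₀ := card_pos.2 ⟨zeroVec, hV0⟩
      exact Nat.eq_of_mul_eq_mul_left hpos this
    have : 2 ^ r = 2 ^ 3 := by rw [e2]; norm_num
    exact Nat.pow_right_injective le_rfl this
  subst hr
  -- `g` as a triple product
  have hgx : ∀ x, g x = ((decide (decide (Odd #(univ.filter fun i => (x i && ζ 0 i) = true)) =
      decide (Odd #(univ.filter fun i => (x₀ i && ζ 0 i) = true))) &&
      decide (decide (Odd #(univ.filter fun i => (x i && ζ 1 i) = true)) = decide (Odd #(univ.filter fun i => (x₀ i && ζ 1 i) = true)))) &&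
      decide (decide (Odd #(univ.filter fun i => (x i && ζ 2 i) = true)) = decide (Odd #(univ.filter fun i => (x₀ i && ζ 2 i) = true)))) := by
    intro x
    have hiff : g x = true ↔ bxor x x₀ ∈ V₀ := by
      rw [show (g x = true) ↔ x ∈ (univ.filter fun x => g x = true) by simp, hVimg x₀ hgx₀, mem_image]
      constructor
      · rintro ⟨a, ha, rfl⟩; rwa [bxor_comm x₀ a, iw_bxor_assoc, bxor_self, bxor_zeroVec]
      · intro h; exact ⟨bxor x x₀, h, by rw [bxor_comm, iw_bxor_assoc, bxor_self, bxor_zeroVec]⟩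
    rw [hζmem] at hiff
    have hpb : ∀ i, decide (Odd #(univ.filter fun j => bxor x x₀ j && ζ i j)) =
        (decide (Odd #(univ.filter fun j => x j && ζ i j)) ^^ decide (Odd #(univ.filter fun j => x₀ j && ζ i j))) :=
      fun i => tow_parity_bxor x x₀ (ζ i)
    simp only [hpb] at hiff
    have L1 : ∀ a b : Bool, (a ^^ b) = false → decide (a = b) = true := by decide
    have L2 : ∀ a b c : Bool, ((a && b) && c) = true → a = true ∧ b = true ∧ c = true := by decide
    have L3 : ∀ a b : Bool, decide (a = b) = true → (a ^^ b) = false := by decide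
    by_cases hg : g x = true
    · have hall := hiff.1 hg
      rw [hg]; symm
      rw [L1 _ _ (hall 0), L1 _ _ (hall 1), L1 _ _ (hall 2)]; rfl
    · rw [Bool.not_eq_true] at hg
      rw [hg]; symm
      rw [Bool.eq_false_iff]
      intro hconj
      obtain ⟨e0, e1, e2⟩ := L2 _ _ _ hconj
      have hall : ∀ i : Fin 3, (decide (Odd #(univ.filter fun j => x j && ζ i j)) ^^ decide (Odd #(univ.filter fun j => x₀ j && ζ i j))) =
          false := by
        intro i
        fin_cases i
        · exact L3 _ _ e0
        · exact L3 _ _ e1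
        · exact L3 _ _ e2
      have := hiff.2 hall
      rw [hg] at this; exact Bool.false_ne_true this
  -- the six forms and their joint kernel
  set F : Fin 6 → (Fin m → Bool) := ![c₀, z₁, z₂, ζ 0, ζ 1, ζ 2] with hF
  set q₀ : Bool := decide (Odd #(univ.filter fun i => (x₀ i && ζ 0 i) = true)) with hq₀
  set q₁ : Bool := decide (Odd #(univ.filter fun i => (x₀ i && ζ 1 i) = true)) with hq₁
  set q₂ : Bool := decide (Odd #(univ.filter fun i => (x₀ i && ζ 2 i) = true)) with hq₂
  set β : Fin 6 → Bool := ![!b₀, b₁, b₂, q₀, q₁, q₂] with hβ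
  have hAGset : (univ.filter fun x => (l x && (decide (decide (Odd #(univ.filter fun i => (x i && z₁ i) = true)) = b₁) &&
      decide (decide (Odd #(univ.filter fun i => (x i && z₂ i) = true)) = b₂))) = true ∧ g x = true) =
      univ.filter fun x : Fin m → Bool => ∀ i : Fin 6, decide (Odd #(univ.filter fun j => x j && F i j)) = β i := by
    ext x
    simp only [mem_filter, mem_univ, true_and]
    rw [hlx, hgx]
    simp only [Fin.forall_fin_succ, IsEmpty.forall_iff, and_true, hF, hβ, Matrix.cons_val_zero, Matrix.cons_val_succ,
      Bool.and_eq_true, decide_eq_true_eq]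
    constructor
    · rintro ⟨h0, ⟨h3, h4⟩, h5⟩
      exact ⟨h0.1, h0.2.1, h0.2.2, h3, h4, h5⟩
    · rintro ⟨h0, h1, h2, h3, h4, h5⟩
      exact ⟨⟨h0, h1, h2⟩, ⟨h3, h4⟩, h5⟩
  obtain ⟨x₁, hx₁⟩ : (univ.filter fun x : Fin m → Bool => ∀ i : Fin 6, decide (Odd #(univ.filter fun j => x j && F i j)) = β i).Nonempty := by
    rw [← hAGset, ← card_pos]; omega
  have hx₁' := (mem_filter.1 hx₁).2
  have hKcard : #(univ.filter fun x : Fin m → Bool => ∀ i : Fin 6, decide (Odd #(univ.filter fun j => x j && F i j)) = false) * 2 ^ 6 =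
      2 ^ m := by
    have himg : (univ.filter fun x : Fin m → Bool => ∀ i : Fin 6, decide (Odd #(univ.filter fun j => x j && F i j)) = β i) =
        (univ.filter fun x : Fin m → Bool => ∀ i : Fin 6, decide (Odd #(univ.filter fun j => x j && F i j)) = false).image
          (fun x => bxor x x₁) := by
      ext y
      simp only [mem_filter, mem_univ, true_and, mem_image]
      constructor
      · intro hy
        refine ⟨bxor y x₁, fun i => ?_, by rw [iw_bxor_assoc, bxor_self, bxor_zeroVec]⟩
        rw [tow_parity_bxor, hy i, hx₁' i, Bool.xor_self]
      · rintro ⟨x, hx, rfl⟩ i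
        rw [tow_parity_bxor, hx i, hx₁' i, Bool.false_xor]
    have hinj : Function.Injective (fun x : Fin m → Bool => bxor x x₁) := fun a b hab => by
      have e := congrArg (fun z : Fin m → Bool => bxor z x₁) hab
      simp only [iw_bxor_assoc, bxor_self, bxor_zeroVec] at e; exact e
    have e : #(univ.filter fun x : Fin m → Bool => ∀ i : Fin 6, decide (Odd #(univ.filter fun j => x j && F i j)) = β i) =
        #(univ.filter fun x : Fin m → Bool => ∀ i : Fin 6, decide (Odd #(univ.filter fun j => x j && F i j)) = false) := by
      rw [himg, card_image_of_injective _ hinj]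
    rw [← e, ← hAGset]
    have : (2 : ℕ) ^ 6 = 64 := by norm_num
    rw [this, mul_comm]; exact hAG
  have hm : 6 ≤ m := by
    by_contra hlt
    have : 2 ^ m < 2 ^ 6 := Nat.pow_lt_pow_right (by norm_num) (by omega)
    have hpos : 0 < #(univ.filter fun x : Fin m → Bool => ∀ i : Fin 6, decide (Odd #(univ.filter fun j => x j && F i j)) = false) :=
      card_pos.2 ⟨zeroVec, mem_filter.2 ⟨mem_univ _, fun i => by simp [zeroVec]⟩⟩
    nlinarith
  obtain ⟨m', rfl⟩ : ∃ m', m = 6 + m' := ⟨m - 6, by omega⟩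
  have hli := tcl_li_of_kernel_card F hKcard
  obtain ⟨P, Pi, hPPi, hPiP, hfr⟩ := tcl_frame_of_li F hli
  refine ⟨hm, P, Pi, hPPi, hPiP, fun y y' y'' x => ?_⟩
  intro Pv e per
  -- the frame reads the six forms as coordinates
  have hread : ∀ (i : Fin 6) (y : Fin (6 + m') → Bool), decide (Odd #(univ.filter fun j => Pv y j && F i j)) = y (e i) := by
    intro i y
    have h := hfr i y
    have hidx : e i = Fin.castAdd m' i := Fin.ext rfl
    rw [hidx]; exact h
  -- the two triple products
  set fA : (Fin (6 + m') → Bool) → Bool := fun t =>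
    (decide (decide (Odd #(univ.filter fun j => t j && c₀ j)) = !b₀) &&
      decide (decide (Odd #(univ.filter fun j => t j && z₁ j)) = b₁)) &&
      decide (decide (Odd #(univ.filter fun j => t j && z₂ j)) = b₂) with hfA
  set fG : (Fin (6 + m') → Bool) → Bool := fun t =>
    (decide (decide (Odd #(univ.filter fun j => t j && ζ 0 j)) = q₀) &&
      decide (decide (Odd #(univ.filter fun j => t j && ζ 1 j)) = q₁)) &&
      decide (decide (Odd #(univ.filter fun j => t j && ζ 2 j)) = q₂) with hfG
  have hT1 := tct3_third_triple_product c₀ z₁ z₂ (!b₀) b₁ b₂ (Pv y) (Pv y') (Pv y'') x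
  have hT2 := tct3_third_triple_product (ζ 0) (ζ 1) (ζ 2) q₀ q₁ q₂ (Pv y) (Pv y') (Pv y'') x
  simp only at hT1 hT2
  have hF0 : F 0 = c₀ := rfl
  have hF1 : F 1 = z₁ := rfl
  have hF2 : F 2 = z₂ := rfl
  have hF3 : F 3 = ζ 0 := rfl
  have hF4 : F 4 = ζ 1 := rfl
  have hF5 : F 5 = ζ 2 := rfl
  have r0 := fun y => hread 0 y; have r1 := fun y => hread 1 y; have r2 := fun y => hread 2 y
  have r3 := fun y => hread 3 y; have r4 := fun y => hread 4 y; have r5 := fun y => hread 5 y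
  simp only [hF0, hF1, hF2, hF3, hF4, hF5] at r0 r1 r2 r3 r4 r5
  -- `ρ = fA ⊕ fG`
  have hρfun : ∀ t, ρ t = (fA t ^^ fG t) := by
    intro t
    rw [hdec t, hlx t, hgx t, hfA, hfG]
    simp only [Bool.and_assoc]
  simp only [hρfun]
  rw [kte_third_xor fA fG (Pv y) (Pv y') (Pv y'') x]
  simp only [hfA, hfG]
  rw [hT1, hT2]
  simp only [r0, r1, r2, r3, r4, r5]
  rfl

end Summit.QuantumAdvantage.QuantumAdvantage.Theorems.CubicForrelation.NearExactIsExact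

end
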